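import Summits.CriticalPhenomena.PercolationContinuityZ3.Theorems.PercAnnulusCrossingIICTargetExistence
import HarnessLib

/-!
# Kesten's IIC limit does not depend on the conditioning — packaged statements (lane RSW3, p1 gen 4)

builds on p205010 (kernel theorem, internal audit signed; external expert review pending)

Seat `prim-rsw3-p1` (gen 4).  Continuation of `PercAnnulusCrossingIICTargetExistence.lean` (Basu–Sapozhnikov Remark 2.1 in kernel form;
split for file size).  A conditioning `{0 ↔ T in W}` is ADMISSIBLE at scale `n₀` if `Λ(n₀) ⊆ W` (finite), `T ⊆ W ∖ Λ(n₀−1)`, and every site of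
`∂ⁱⁿΛ(n₀)` is joined to `T` by a lattice walk inside `W ∖ Λ(n₀−1)`.  Helper file; no definitions, no sorries.
* `box_target_admissible`, `cond_box_eq`, `target_admissible_mono` — the sup-norm sphere is admissible; admissibility is monotone in `n₀`;
* **`iic_limit_condIndep_of_setToSetQuasiMultAspectAt`** — under (A2)□ at aspect `(s, L)` (`s ≥ 2`), `θ(p) = 0`, `0 < p`, `d ≥ 1`: the box
  IIC limit `ν(E) = lim_n P(E | 0 ↔ ∂ⁱⁿΛ(n))` exists AND `P(E | 0 ↔ T in W) → ν(E)` uniformly over admissible conditionings as `n₀ → ∞`;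
* **`iic_limit_condIndep_criticalProbI_of_setToSetQuasiMultAspectAt`** — the same at `p_c(ℤ^d)`, `d ≥ 2`.
References: D. Basu, A. Sapozhnikov, ECP 22 (2017) no. 26, Thm. 1.1 and Remark 2.1; H. Kesten, PTRF 73 (1986) Thm. (3).
-/

noncomputable section

namespace Summit.CriticalPhenomena.PercolationContinuityZ3.Theorems.Crossing

open MeasureTheory Literature.Probability.Percolation Literature.Probability.LatticeModels
open Literature.Probability.Percolation.DCT16
open Summit.CriticalPhenomena.PercolationContinuityZ3.Theorems.SurfaceTension
open scoped Literature.Probability.Percolation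
open Filter Topology Literature.Probability.Percolation.DKT20

variable {d : ℕ}

/-! ## Admissibility of the box target; the packaged statements -/

/-- The sup-norm sphere `∂ⁱⁿΛ(n)` inside `Λ(n)` is an admissible target at every reference scale `1 ≤ n₀ ≤ n`. [folklore] -/
theorem box_target_admissible {n₀ n : ℕ} (hn₀ : 1 ≤ n₀) (hn : n₀ ≤ n) :
    box d n₀ ⊆ box d n ∧ innerBoundary (zdGraph d) (box d n) ⊆ box d n ∧
      (∀ t ∈ innerBoundary (zdGraph d) (box d n), t ∉ box d (n₀ - 1)) ∧
      (∀ x ∈ innerBoundary (zdGraph d) (box d n₀), ∃ t ∈ innerBoundary (zdGraph d) (box d n), ∃ q : (zdGraph d).Walk x t,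
        ∀ z ∈ q.support, z ∈ (↑(box d n) : Set (Site d)) \ ↑(box d (n₀ - 1))) :=
  ⟨box_mono d hn, fun _ ht => (Finset.mem_filter.1 ht).1, fun _ ht => notMem_box_of_mem_innerBoundary_box (by omega) ht,
    fun _ hx => exists_walk_innerBoundary_box hn₀ hn hx⟩

/-- `{0 ↔ ∂ⁱⁿΛ(n) in Λ(n)}` is the one-arm event `siteToBoundary d n`. [folklore] -/
theorem cond_box_eq (n : ℕ) :
    {ω : BondConfig (Site d) | ∃ t ∈ innerBoundary (zdGraph d) (box d n), ω ∈ openConnIn (↑(box d n) : Set (Site d)) 0 t} =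
      siteToBoundary d n := by
  rw [← cond_zero_eq, conn_empty_zero_eq]

/-- Admissibility is monotone in the reference scale: a target admissible at scale `n ≥ n₀ ≥ 1` (with `Λ(n) ⊆ W`) is admissible at
scale `n₀` (prefix the reaching walk by a straight ray from `∂ⁱⁿΛ(n₀)` to `∂ⁱⁿΛ(n)`). [folklore] -/
theorem target_admissible_mono {n₀ n : ℕ} (hn₀ : 1 ≤ n₀) (hn : n₀ ≤ n) {W T : Finset (Site d)} (hW : box d n ⊆ W)
    (hTn : ∀ t ∈ T, t ∉ box d (n - 1))
    (hTr : ∀ x ∈ innerBoundary (zdGraph d) (box d n), ∃ t ∈ T, ∃ q : (zdGraph d).Walk x t,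
      ∀ z ∈ q.support, z ∈ (↑W : Set (Site d)) \ ↑(box d (n - 1))) :
    box d n₀ ⊆ W ∧ (∀ t ∈ T, t ∉ box d (n₀ - 1)) ∧
      (∀ x ∈ innerBoundary (zdGraph d) (box d n₀), ∃ t ∈ T, ∃ q : (zdGraph d).Walk x t,
        ∀ z ∈ q.support, z ∈ (↑W : Set (Site d)) \ ↑(box d (n₀ - 1))) := by
  refine ⟨(box_mono d hn).trans hW, fun t ht h => hTn t ht (box_mono d (by omega) h), fun x hx => ?_⟩
  obtain ⟨s, hs, q₁, hq₁⟩ := exists_walk_innerBoundary_box hn₀ hn hx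
  obtain ⟨t, ht, q₂, hq₂⟩ := hTr s hs
  refine ⟨t, ht, q₁.append q₂, fun z hz => ?_⟩
  rw [SimpleGraph.Walk.mem_support_append_iff] at hz
  rcases hz with hz | hz
  · exact ⟨Finset.mem_coe.2 (hW (Finset.mem_coe.1 (hq₁ z hz).1)), (hq₁ z hz).2⟩
  · exact ⟨(hq₂ z hz).1, fun h => (hq₂ z hz).2 (Finset.mem_coe.2 (box_mono d (by omega) (Finset.mem_coe.1 h)))⟩

/-- **Kesten's IIC limit is independent of the conditioning (Basu–Sapozhnikov Remark 2.1), under (A2)□ at aspect `(s, L)`.**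
`d ≥ 1`, `0 < p`, `θ(p) = 0`, `s ≥ 2`, `ϰ > 0`.  For every cylinder event `E`: the box IIC limit `ν(E) = lim_n P(E | 0 ↔ ∂ⁱⁿΛ(n))` exists
(part XX′), and `P(E | 0 ↔ T in W) → ν(E)` UNIFORMLY over all admissible conditionings — finite `W ⊇ Λ(n₀)`, `T ⊆ W ∖ Λ(n₀−1)` reachable
from every site of `∂ⁱⁿΛ(n₀)` inside `W ∖ Λ(n₀−1)` — as `n₀ → ∞`.  In particular the graph-metric spheres of the printed theorem and the
sup-norm spheres give the same IIC (part `…TargetGraphMetric`).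
[cite: BasuSapozhnikov2017ECP, Remark 2.1 and Thm. 1.1] [cite: Kesten1986, Thm. (3)] -/
theorem iic_limit_condIndep_of_setToSetQuasiMultAspectAt (hd : 1 ≤ d) (p : unitInterval) (hp : 0 < (p : ℝ))
    (hθ : theta (zdGraph d) 0 p = 0) {s L : ℕ} (hs : 2 ≤ s) {ϰ : ℝ} (hϰ : 0 < ϰ) (hA2 : SetToSetQuasiMultAspectAt d p s L ϰ)
    (F : Finset (Sym2 (Site d))) (E : Set (BondConfig (Site d))) (hEm : MeasurableSet E) (hEF : DeterminedBy E ↑F) :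
    ∃ ν : ℝ, Tendsto (fun n : ℕ => (bondPercolation (zdGraph d) p).real (E ∩ siteToBoundary d n) / oneArmProb d p n) atTop (𝓝 ν) ∧
      ∀ δ : ℝ, 0 < δ → ∃ n₀ : ℕ, 1 ≤ n₀ ∧ ∀ W T : Finset (Site d), box d n₀ ⊆ W → T ⊆ W → (∀ t ∈ T, t ∉ box d (n₀ - 1)) →
        (∀ x ∈ innerBoundary (zdGraph d) (box d n₀), ∃ t ∈ T, ∃ q : (zdGraph d).Walk x t,
          ∀ z ∈ q.support, z ∈ (↑W : Set (Site d)) \ ↑(box d (n₀ - 1))) →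
        |(bondPercolation (zdGraph d) p).real (E ∩ {ω | ∃ t ∈ T, ω ∈ openConnIn (↑W : Set (Site d)) 0 t}) /
            (bondPercolation (zdGraph d) p).real {ω | ∃ t ∈ T, ω ∈ openConnIn (↑W : Set (Site d)) 0 t} - ν| ≤ δ := by
  obtain ⟨ν, hν⟩ := kestenIICExistsAt_of_setToSetQuasiMultAspectAt hd p hp hθ hs hϰ hA2 F E hEm hEF
  refine ⟨ν, hν, fun δ hδ => ?_⟩
  have hA2' : SetToSetQuasiMultAspectAt d p s (max L (s + 1)) ϰ := hA2.mono_outer (le_max_left _ _)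
  have hσ' : ∀ m : ℕ, 1 ≤ m → m < s * m := fun m hm => by have := Nat.mul_le_mul_right m hs; omega
  have hστ' : ∀ m : ℕ, 1 ≤ m → s * m < max L (s + 1) * m := fun m hm =>
    Nat.mul_lt_mul_of_pos_right (lt_of_lt_of_le (Nat.lt_succ_self s) (le_max_right _ _)) (by omega)
  obtain ⟨n₀, hn₀, hunif⟩ := iic_ratio_condIndep_of_setToSetQM_aspect hd p hp hθ hϰ (σ := fun m => s * m)
    (τ := fun m => max L (s + 1) * m) hσ' hστ' (fun a b hab => Nat.mul_le_mul_left s hab) (fun a b hab => Nat.mul_le_mul_left _ hab)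
    (fun m hm Z hZ X hX Y hY => by rw [mul_assoc]; exact hA2' m hm Z hZ X hX Y hY) F E hEF (half_pos hδ)
  obtain ⟨n₁, hn₁⟩ := Metric.tendsto_atTop.1 hν (δ / 2) (half_pos hδ)
  refine ⟨max n₀ n₁, le_max_of_le_left hn₀, fun W T hW hTW hTn hTr => ?_⟩
  set n := max n₀ n₁ with hn
  have hn₀n : n₀ ≤ n := le_max_left _ _
  obtain ⟨hW₀, hTn₀, hTr₀⟩ := target_admissible_mono hn₀ hn₀n hW hTn hTr
  obtain ⟨hB1, hB2, hB3, hB4⟩ := box_target_admissible (d := d) hn₀ hn₀n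
  have h1 := hunif W T (box d n) (innerBoundary (zdGraph d) (box d n)) hW₀ hTW hTn₀ hTr₀ hB1 hB2 hB3 hB4
  rw [cond_box_eq] at h1
  have h2 := hn₁ n (le_max_right _ _)
  rw [Real.dist_eq] at h2
  change |(bondPercolation (zdGraph d) p).real (E ∩ siteToBoundary d n) / (bondPercolation (zdGraph d) p).real (siteToBoundary d n) - ν|
    < δ / 2 at h2
  rw [abs_sub_le_iff] at h1 ⊢
  rw [abs_sub_lt_iff] at h2
  constructor <;> linarith [h1.1, h1.2, h2.1, h2.2]

/-- **Kesten's IIC limit at `p_c(ℤ^d)` is independent of the conditioning, under (A2)□ at aspect `(s, L)`** (`d ≥ 2`, `s ≥ 2`;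
`θ(p_c) = 0` by `CSH.percolationContinuity_allDimensions`): Basu–Sapozhnikov's Theorem 1.1 WITH their Remark 2.1, at criticality, in
box form — in particular the IIC obtained from the graph-metric spheres of the printed statement is the box IIC of part XX′.
[cite: BasuSapozhnikov2017ECP, Thm. 1.1 and Remark 2.1] [cite: Kesten1986, Thm. (3)] -/
theorem iic_limit_condIndep_criticalProbI_of_setToSetQuasiMultAspectAt (hd : 2 ≤ d) {s L : ℕ} (hs : 2 ≤ s) {ϰ : ℝ} (hϰ : 0 < ϰ)
    (hA2 : SetToSetQuasiMultAspectAt d (criticalProbI d) s L ϰ)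
    (F : Finset (Sym2 (Site d))) (E : Set (BondConfig (Site d))) (hEm : MeasurableSet E) (hEF : DeterminedBy E ↑F) :
    ∃ ν : ℝ, Tendsto (fun n : ℕ => (bondPercolation (zdGraph d) (criticalProbI d)).real (E ∩ siteToBoundary d n) /
        oneArmProb d (criticalProbI d) n) atTop (𝓝 ν) ∧
      ∀ δ : ℝ, 0 < δ → ∃ n₀ : ℕ, 1 ≤ n₀ ∧ ∀ W T : Finset (Site d), box d n₀ ⊆ W → T ⊆ W → (∀ t ∈ T, t ∉ box d (n₀ - 1)) →
        (∀ x ∈ innerBoundary (zdGraph d) (box d n₀), ∃ t ∈ T, ∃ q : (zdGraph d).Walk x t,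
          ∀ z ∈ q.support, z ∈ (↑W : Set (Site d)) \ ↑(box d (n₀ - 1))) →
        |(bondPercolation (zdGraph d) (criticalProbI d)).real (E ∩ {ω | ∃ t ∈ T, ω ∈ openConnIn (↑W : Set (Site d)) 0 t}) /
            (bondPercolation (zdGraph d) (criticalProbI d)).real {ω | ∃ t ∈ T, ω ∈ openConnIn (↑W : Set (Site d)) 0 t} - ν| ≤ δ := by
  have hpc : 0 < ((criticalProbI d : unitInterval) : ℝ) := by
    have h := Literature.Barriers.CriticalPhenomena.criticalProbI_pos' (d := d) (by omega)
    exact_mod_cast h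
  exact iic_limit_condIndep_of_setToSetQuasiMultAspectAt (by omega) (criticalProbI d) hpc (CSH.percolationContinuity_allDimensions d hd)
    hs hϰ hA2 F E hEm hEF

end Summit.CriticalPhenomena.PercolationContinuityZ3.Theorems.Crossing

end
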